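import Mathlib
import Summits.RiemannHypothesis.RiemannHypothesis.Theorems.SoloBlindDeepPairInvisible

/-!
# SoloBlind artefact 16 — universal shallow-pair invisibility in the critical lattice (Theorem U)

Context (soloist `solo-RiemannHypothesis-blind`, report `paper/window-height.md` §12, claim C59).
Notation as in artefacts 7/12/13: window `(-a, a]`, test function `g ∈ L²` supported there,
`H_g(z) = ∫ g(x) e^{izx} dx` (written out as an integral in every statement); the on-line lattice
`u_j = u₀ + j s` (`j ∈ ℤ`) with `2a ≤ T := 2π/s`.  A zero ON the line at ordinate `u` contributes
`|H_g(u)|²` to the zero side of the explicit formula for `g ⋆ g̃`; a conjugate pair OFF the line by `δ`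
at ordinate `u` contributes `2 Re[H_g(u - iδ) conj H_g(u + iδ)]`.

**Mixed configuration `Z(P, δ)`.**  For an ARBITRARY set of sites `P ⊆ ℤ`, replace the on-line zero at
every `u_j`, `j ∈ P`, by the off-line pair `u_j ∓ iδ` (common depth `δ ≥ 0`), and keep the on-line zero
at every `u_j`, `j ∉ P`.  Its zero-side functional is
`Q(g) = Σ_{j ∉ P} |H_g(u_j)|² + Σ_{j ∈ P} 2 Re[H_g(u_j - iδ) conj H_g(u_j + iδ)]`.

* `soloBlind_universal_invisible`: the series converges (unconditionally) and
  `Q(g) ≥ (2π/s) · (1 - 2 sinh²(δa) - 2 (cosh(δa) - 1)²) · ‖g‖₂²`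
  for EVERY `g ∈ L²` on the window, EVERY `P ⊆ ℤ`, every offset `u₀` — no symmetry, no periodicity,
  no sparsity of `P` is assumed.  (`1 - 2 sinh² x - 2(cosh x - 1)² = 1 - 4 cosh x (cosh x - 1)`.)
* `soloBlind_universal_nonneg`: hence `Q(g) ≥ 0` whenever `4 cosh(δa)(cosh(δa) - 1) ≤ 1`
  (i.e. `δ a ≤ arccosh((1+√2)/2) = 0.6329…`), and
* `soloBlind_universal_nonneg_of_le`: in particular whenever `δ · a ≤ 4/7`.

Mechanism (three lines): with `C_j = ∫ g cosh(δ·) e^{iu_j·}`, `S_j = ∫ g sinh(δ·) e^{iu_j·}`,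
`E_j = ∫ g (cosh(δ·) - 1) e^{iu_j·}` one has `H_g(u_j ∓ iδ) = C_j ± S_j`, pair term `= 2|C_j|² - 2|S_j|²`
(artefact 13), `C_j = H_g(u_j) + E_j` so `2|C_j|² ≥ |H_g(u_j)|² - 2|E_j|²`; summing, `Q ≥ Σ_ℤ |H_g(u_j)|²
- 2 Σ_ℤ (|E_j|² + |S_j|²)`, and the three full lattice sums are `(2π/s)‖g‖²`, `(2π/s)‖g (cosh - 1)‖²`,
`(2π/s)‖g sinh‖²` by Theorem D1 (artefact 7) applied to `g`, `g·(cosh(δ·) - 1)`, `g·sinh(δ·)`.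
This contains artefact 13's single-pair theorem (`P = {0}`, threshold `4a sinh²(δa) ≤ T`) only up to the
constant: at `T = 2a` the universal threshold proved here is `δa ≤ 0.6329`, the single-pair one `0.6585`.

Mathlib + artefacts 7/13 only; no sorries.
-/

open MeasureTheory Complex Set
open scoped Real ComplexConjugate

namespace Summit.RiemannHypothesis.RiemannHypothesis.Theorems

/-- Theorem D1 at `δ = 0`, real form: `Σ_j |H_G(u₀ + js)|² = (2π/s) ‖G‖₂²` for `G ∈ L²` supported in an
interval of length `2π/s`. -/
theorem soloBlind_lattice_normSq_hasSum (c s u₀ : ℝ) (hs : 0 < s) {G : ℝ → ℂ}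
    (hG : MemLp G 2 volume) (hsupp : Function.support G ⊆ Ioc c (c + 2 * π / s)) :
    HasSum (fun j : ℤ => ‖(∫ x : ℝ, G x * cexp (I * (((u₀ + j * s : ℝ) : ℂ)) * (x : ℂ)))‖ ^ 2)
      ((2 * π / s) * ∫ x : ℝ, ‖G x‖ ^ 2) := by
  have h0 := soloBlind_lattice_blindness c s u₀ 0 hs hG hsupp
  have hterm : ∀ j : ℤ, (∫ x : ℝ, G x * cexp (I * (((u₀ + j * s : ℝ) : ℂ) - I * (0 : ℝ)) * x)) *
        conj (∫ x : ℝ, G x * cexp (I * (((u₀ + j * s : ℝ) : ℂ) + I * (0 : ℝ)) * x))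
      = ((‖(∫ x : ℝ, G x * cexp (I * (((u₀ + j * s : ℝ) : ℂ)) * (x : ℂ)))‖ ^ 2 : ℝ) : ℂ) := by
    intro j
    have e1 : (((u₀ + j * s : ℝ) : ℂ) - I * (0 : ℝ)) = ((u₀ + j * s : ℝ) : ℂ) := by simp
    have e2 : (((u₀ + j * s : ℝ) : ℂ) + I * (0 : ℝ)) = ((u₀ + j * s : ℝ) : ℂ) := by simp
    rw [e1, e2, Complex.mul_conj, Complex.normSq_eq_norm_sq]
  simp_rw [hterm] at h0
  exact Complex.hasSum_ofReal.mp h0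

/-- A continuous weight bounded by `W` on the closed window keeps a window `L²` function in `L²`. -/
theorem soloBlind_memLp_mul_weight {g : ℝ → ℂ} {a : ℝ} (hg : MemLp g 2 volume)
    (hsupp : Function.support g ⊆ Ioc (-a) a) {w : ℝ → ℝ} (hw : Continuous w) (W : ℝ)
    (hW : ∀ x ∈ Icc (-a) a, |w x| ≤ W) :
    MemLp (fun x => g x * ((w x : ℝ) : ℂ)) 2 volume := by
  have hbound : ∀ x, ‖g x * ((w x : ℝ) : ℂ)‖ ≤ W * ‖g x‖ := by
    intro x
    by_cases hx : g x = 0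
    · simp [hx]
    · have hxI : x ∈ Icc (-a) a := Ioc_subset_Icc_self (hsupp hx)
      rw [norm_mul, Complex.norm_real, Real.norm_eq_abs, mul_comm (‖g x‖) (|w x|)]
      exact mul_le_mul_of_nonneg_right (hW x hxI) (norm_nonneg _)
  have hmeas : AEStronglyMeasurable (fun x => g x * ((w x : ℝ) : ℂ)) volume :=
    hg.aestronglyMeasurable.mul (Complex.continuous_ofReal.comp hw).aestronglyMeasurable
  exact hg.of_le_mul (c := W) hmeas (Filter.Eventually.of_forall hbound)

/-- `∫ ‖g·w‖² ≤ W² ∫ ‖g‖²` for a weight bounded by `W` on the closed window. -/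
theorem soloBlind_sqInt_mul_weight_le {g : ℝ → ℂ} {a : ℝ} (hg2 : Integrable (fun x => ‖g x‖ ^ 2))
    (hsupp : Function.support g ⊆ Ioc (-a) a) {w : ℝ → ℝ} (W : ℝ)
    (hW : ∀ x ∈ Icc (-a) a, |w x| ≤ W) :
    ∫ x, ‖g x * ((w x : ℝ) : ℂ)‖ ^ 2 ≤ W ^ 2 * ∫ x, ‖g x‖ ^ 2 := by
  rw [← integral_const_mul]
  apply integral_mono_of_nonneg
  · exact Filter.Eventually.of_forall (fun x => by positivity)
  · exact hg2.const_mul _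
  · refine Filter.Eventually.of_forall (fun x => ?_)
    by_cases hx : g x = 0
    · simp [hx]
    · have hxI : x ∈ Icc (-a) a := Ioc_subset_Icc_self (hsupp hx)
      have h1 : |w x| ^ 2 ≤ W ^ 2 := pow_le_pow_left₀ (abs_nonneg _) (hW x hxI) 2
      show ‖g x * ((w x : ℝ) : ℂ)‖ ^ 2 ≤ W ^ 2 * ‖g x‖ ^ 2
      rw [norm_mul, Complex.norm_real, Real.norm_eq_abs, mul_pow]
      nlinarith [sq_nonneg ‖g x‖, h1]

/-- An integrable function times a unimodular exponential `e^{iux}` (`u` real) is integrable. -/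
theorem soloBlind_integrable_mul_cexp {G : ℝ → ℂ} (hG : Integrable G) (u : ℝ) :
    Integrable (fun x : ℝ => G x * cexp (I * (u : ℂ) * (x : ℂ))) := by
  refine hG.mul_bdd (c := 1) ?_ (Filter.Eventually.of_forall fun x => ?_)
  · exact (by fun_prop : Continuous fun x : ℝ => cexp (I * (u : ℂ) * (x : ℂ))).aestronglyMeasurable
  · rw [show I * (u : ℂ) * (x : ℂ) = ((u * x : ℝ) : ℂ) * I by push_cast; ring,
      Complex.norm_exp_ofReal_mul_I]

/-- Exponent bookkeeping: `e^{i(u - iδ)x} = e^{iux} cosh(δx) + e^{iux} sinh(δx)`. -/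
theorem soloBlind_cexp_minus_split (u δ x : ℝ) :
    cexp (I * ((u : ℂ) - I * δ) * (x : ℂ)) =
      cexp (I * (u : ℂ) * (x : ℂ)) * ((Real.cosh (δ * x) : ℝ) : ℂ)
        + cexp (I * (u : ℂ) * (x : ℂ)) * ((Real.sinh (δ * x) : ℝ) : ℂ) := by
  rw [← mul_add, ← Complex.ofReal_add, Real.cosh_add_sinh, Complex.ofReal_exp, ← Complex.exp_add]
  congr 1
  push_cast
  linear_combination (-(δ : ℂ) * (x : ℂ)) * Complex.I_mul_I

/-- Exponent bookkeeping: `e^{i(u + iδ)x} = e^{iux} cosh(δx) - e^{iux} sinh(δx)`. -/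
theorem soloBlind_cexp_plus_split (u δ x : ℝ) :
    cexp (I * ((u : ℂ) + I * δ) * (x : ℂ)) =
      cexp (I * (u : ℂ) * (x : ℂ)) * ((Real.cosh (δ * x) : ℝ) : ℂ)
        - cexp (I * (u : ℂ) * (x : ℂ)) * ((Real.sinh (δ * x) : ℝ) : ℂ) := by
  rw [← mul_sub, ← Complex.ofReal_sub, Real.cosh_sub_sinh, Complex.ofReal_exp, ← Complex.exp_add]
  congr 1
  push_cast
  linear_combination ((δ : ℂ) * (x : ℂ)) * Complex.I_mul_I

/-- **Theorem U (universal shallow-pair invisibility).**  Let `0 < s`, `0 < a`, `2a ≤ 2π/s`, `0 ≤ δ`,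
`P ⊆ ℤ` arbitrary, `g ∈ L²` supported in `(-a, a]`.  The zero-side functional of the mixed configuration
`Z(P, δ)` — pair terms at the sites `j ∈ P`, on-line terms at the sites `j ∉ P` of the lattice `u₀ + sℤ` —
converges and is at least `(2π/s)(1 - 2 sinh²(δa) - 2(cosh(δa) - 1)²) ‖g‖₂²`. -/
theorem soloBlind_universal_invisible (s δ a u₀ : ℝ) (hs : 0 < s) (ha : 0 < a) (hδ : 0 ≤ δ)
    (haT : 2 * a ≤ 2 * π / s) (P : Set ℤ) [DecidablePred (· ∈ P)]
    {g : ℝ → ℂ} (hg : MemLp g 2 volume) (hsupp : Function.support g ⊆ Ioc (-a) a) :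
    Summable (fun j : ℤ => if j ∈ P then
        2 * ((∫ x : ℝ, g x * cexp (I * (((u₀ + j * s : ℝ) : ℂ) - I * δ) * (x : ℂ))) *
            conj ((∫ x : ℝ, g x * cexp (I * (((u₀ + j * s : ℝ) : ℂ) + I * δ) * (x : ℂ))))).re
      else ‖(∫ x : ℝ, g x * cexp (I * (((u₀ + j * s : ℝ) : ℂ)) * (x : ℂ)))‖ ^ 2) ∧
    (2 * π / s) * (1 - 2 * Real.sinh (δ * a) ^ 2 - 2 * (Real.cosh (δ * a) - 1) ^ 2) *
        (∫ x : ℝ, ‖g x‖ ^ 2) ≤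
      ∑' j : ℤ, (if j ∈ P then
        2 * ((∫ x : ℝ, g x * cexp (I * (((u₀ + j * s : ℝ) : ℂ) - I * δ) * (x : ℂ))) *
            conj ((∫ x : ℝ, g x * cexp (I * (((u₀ + j * s : ℝ) : ℂ) + I * δ) * (x : ℂ))))).re
      else ‖(∫ x : ℝ, g x * cexp (I * (((u₀ + j * s : ℝ) : ℂ)) * (x : ℂ)))‖ ^ 2) := by
  have hT : 0 < 2 * π / s := by positivity
  -- integrability of `g` and `‖g‖²`
  have hgi : Integrable g := by
    have hm : MemLp g 2 (volume.restrict (Ioc (-a) a)) := hg.restrict _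
    haveI : IsFiniteMeasure (volume.restrict (Ioc (-a) a)) :=
      isFiniteMeasure_restrict.mpr (by simp [Real.volume_Ioc])
    have h1 : IntegrableOn g (Ioc (-a) a) := hm.integrable one_le_two
    exact (integrableOn_iff_integrable_of_support_subset hsupp).mp h1
  have hg2 : Integrable (fun x => ‖g x‖ ^ 2) := (memLp_two_iff_integrable_sq_norm hg.1).mp hg
  -- the three weights and their bounds on the closed window
  have hWs : ∀ x ∈ Icc (-a) a, |Real.sinh (δ * x)| ≤ Real.sinh (δ * a) := by
    intro x hx
    rw [abs_le]
    constructor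
    · rw [← Real.sinh_neg, Real.sinh_le_sinh]
      nlinarith [mul_nonneg hδ (show 0 ≤ x + a by linarith [hx.1])]
    · rw [Real.sinh_le_sinh]
      nlinarith [mul_nonneg hδ (show 0 ≤ a - x by linarith [hx.2])]
  have hWc : ∀ x ∈ Icc (-a) a, |Real.cosh (δ * x)| ≤ Real.cosh (δ * a) := by
    intro x hx
    rw [abs_of_pos (Real.cosh_pos _), Real.cosh_le_cosh, abs_mul, abs_mul, abs_of_nonneg hδ,
      abs_of_pos ha]
    exact mul_le_mul_of_nonneg_left (abs_le.mpr ⟨by linarith [hx.1], hx.2⟩) hδ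
  have hWe : ∀ x ∈ Icc (-a) a, |Real.cosh (δ * x) - 1| ≤ Real.cosh (δ * a) - 1 := by
    intro x hx
    have h1 : 1 ≤ Real.cosh (δ * x) := Real.one_le_cosh _
    have h2 := hWc x hx
    rw [abs_of_pos (Real.cosh_pos _)] at h2
    rw [abs_of_nonneg (by linarith)]
    linarith
  have hcont_s : Continuous fun x : ℝ => Real.sinh (δ * x) :=
    Real.continuous_sinh.comp (continuous_const.mul continuous_id)
  have hcont_c : Continuous fun x : ℝ => Real.cosh (δ * x) :=
    Real.continuous_cosh.comp (continuous_const.mul continuous_id)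
  have hcont_e : Continuous fun x : ℝ => Real.cosh (δ * x) - 1 := hcont_c.sub continuous_const
  -- the weighted window functions are in `L²`, integrable, supported in one period
  have hGS2 : MemLp (fun x => g x * ((Real.sinh (δ * x) : ℝ) : ℂ)) 2 volume :=
    soloBlind_memLp_mul_weight (w := fun x => Real.sinh (δ * x)) hg hsupp hcont_s _ hWs
  have hGC2 : MemLp (fun x => g x * ((Real.cosh (δ * x) : ℝ) : ℂ)) 2 volume :=
    soloBlind_memLp_mul_weight (w := fun x => Real.cosh (δ * x)) hg hsupp hcont_c _ hWc
  have hGE2 : MemLp (fun x => g x * (((Real.cosh (δ * x) - 1 : ℝ)) : ℂ)) 2 volume :=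
    soloBlind_memLp_mul_weight (w := fun x => Real.cosh (δ * x) - 1) hg hsupp hcont_e _ hWe
  have hGSi : Integrable (fun x => g x * ((Real.sinh (δ * x) : ℝ) : ℂ)) :=
    soloBlind_integrable_mul_weight (w := fun x => Real.sinh (δ * x)) hgi hsupp hcont_s _ hWs
  have hGCi : Integrable (fun x => g x * ((Real.cosh (δ * x) : ℝ) : ℂ)) :=
    soloBlind_integrable_mul_weight (w := fun x => Real.cosh (δ * x)) hgi hsupp hcont_c _ hWc
  have hGEi : Integrable (fun x => g x * (((Real.cosh (δ * x) - 1 : ℝ)) : ℂ)) :=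
    soloBlind_integrable_mul_weight (w := fun x => Real.cosh (δ * x) - 1) hgi hsupp hcont_e _ hWe
  have hsuppT : Function.support g ⊆ Ioc (-a) (-a + 2 * π / s) :=
    hsupp.trans (Ioc_subset_Ioc_right (by linarith))
  have hsub : ∀ w : ℝ → ℝ,
      Function.support (fun x => g x * ((w x : ℝ) : ℂ)) ⊆ Ioc (-a) (-a + 2 * π / s) :=
    fun w => (Function.support_mul_subset_left _ _).trans hsuppT
  -- the four full lattice sums, by Theorem D1 at δ = 0
  have hH := soloBlind_lattice_normSq_hasSum (-a) s u₀ hs hg hsuppT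
  have hS := soloBlind_lattice_normSq_hasSum (-a) s u₀ hs hGS2 (hsub _)
  have hC := soloBlind_lattice_normSq_hasSum (-a) s u₀ hs hGC2 (hsub _)
  have hE := soloBlind_lattice_normSq_hasSum (-a) s u₀ hs hGE2 (hsub _)
  -- bounds for the weighted square integrals
  have hSle : ∫ x, ‖g x * ((Real.sinh (δ * x) : ℝ) : ℂ)‖ ^ 2
      ≤ Real.sinh (δ * a) ^ 2 * ∫ x, ‖g x‖ ^ 2 :=
    soloBlind_sqInt_mul_weight_le hg2 hsupp _ hWs
  have hEle : ∫ x, ‖g x * (((Real.cosh (δ * x) - 1 : ℝ)) : ℂ)‖ ^ 2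
      ≤ (Real.cosh (δ * a) - 1) ^ 2 * ∫ x, ‖g x‖ ^ 2 :=
    soloBlind_sqInt_mul_weight_le hg2 hsupp _ hWe
  -- pointwise identities at each site `j`
  have hHm : ∀ j : ℤ, (∫ x : ℝ, g x * cexp (I * (((u₀ + j * s : ℝ) : ℂ) - I * δ) * (x : ℂ))) =
      (∫ x : ℝ, (g x * ((Real.cosh (δ * x) : ℝ) : ℂ)) * cexp (I * (((u₀ + j * s : ℝ) : ℂ)) * (x : ℂ)))
      + ∫ x : ℝ, (g x * ((Real.sinh (δ * x) : ℝ) : ℂ)) * cexp (I * (((u₀ + j * s : ℝ) : ℂ)) * (x : ℂ)) := by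
    intro j
    rw [← integral_add (soloBlind_integrable_mul_cexp hGCi _) (soloBlind_integrable_mul_cexp hGSi _)]
    congr 1; funext x
    rw [soloBlind_cexp_minus_split]
    ring
  have hHp : ∀ j : ℤ, (∫ x : ℝ, g x * cexp (I * (((u₀ + j * s : ℝ) : ℂ) + I * δ) * (x : ℂ))) =
      (∫ x : ℝ, (g x * ((Real.cosh (δ * x) : ℝ) : ℂ)) * cexp (I * (((u₀ + j * s : ℝ) : ℂ)) * (x : ℂ)))
      - ∫ x : ℝ, (g x * ((Real.sinh (δ * x) : ℝ) : ℂ)) * cexp (I * (((u₀ + j * s : ℝ) : ℂ)) * (x : ℂ)) := by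
    intro j
    rw [← integral_sub (soloBlind_integrable_mul_cexp hGCi _) (soloBlind_integrable_mul_cexp hGSi _)]
    congr 1; funext x
    rw [soloBlind_cexp_plus_split]
    ring
  have hCE : ∀ j : ℤ,
      (∫ x : ℝ, (g x * ((Real.cosh (δ * x) : ℝ) : ℂ)) * cexp (I * (((u₀ + j * s : ℝ) : ℂ)) * (x : ℂ))) =
      (∫ x : ℝ, g x * cexp (I * (((u₀ + j * s : ℝ) : ℂ)) * (x : ℂ)))
      + ∫ x : ℝ, (g x * (((Real.cosh (δ * x) - 1 : ℝ)) : ℂ)) * cexp (I * (((u₀ + j * s : ℝ) : ℂ)) * (x : ℂ)) := by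
    intro j
    rw [← integral_add (soloBlind_integrable_mul_cexp hgi _) (soloBlind_integrable_mul_cexp hGEi _)]
    congr 1; funext x
    push_cast
    ring
  -- abbreviations for the four site values
  set Hj : ℤ → ℂ := fun j => ∫ x : ℝ, g x * cexp (I * (((u₀ + j * s : ℝ) : ℂ)) * (x : ℂ)) with hHj
  set Cj : ℤ → ℂ := fun j =>
    ∫ x : ℝ, (g x * ((Real.cosh (δ * x) : ℝ) : ℂ)) * cexp (I * (((u₀ + j * s : ℝ) : ℂ)) * (x : ℂ)) with hCj
  set Sj : ℤ → ℂ := fun j =>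
    ∫ x : ℝ, (g x * ((Real.sinh (δ * x) : ℝ) : ℂ)) * cexp (I * (((u₀ + j * s : ℝ) : ℂ)) * (x : ℂ)) with hSj
  set Ej : ℤ → ℂ := fun j =>
    ∫ x : ℝ, (g x * (((Real.cosh (δ * x) - 1 : ℝ)) : ℂ)) * cexp (I * (((u₀ + j * s : ℝ) : ℂ)) * (x : ℂ))
    with hEj
  -- the functional, rewritten site by site
  have hF : (fun j : ℤ => if j ∈ P then
        2 * ((∫ x : ℝ, g x * cexp (I * (((u₀ + j * s : ℝ) : ℂ) - I * δ) * (x : ℂ))) *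
            conj ((∫ x : ℝ, g x * cexp (I * (((u₀ + j * s : ℝ) : ℂ) + I * δ) * (x : ℂ))))).re
      else ‖(∫ x : ℝ, g x * cexp (I * (((u₀ + j * s : ℝ) : ℂ)) * (x : ℂ)))‖ ^ 2)
      = fun j : ℤ => if j ∈ P then 2 * ‖Cj j‖ ^ 2 - 2 * ‖Sj j‖ ^ 2 else ‖Hj j‖ ^ 2 := by
    funext j
    split_ifs with hj
    · rw [hHm j, hHp j, soloBlind_pairTerm_re]
    · rfl
  -- summability: `|F j| ≤ 2|C_j|² + 2|S_j|² + |H_j|²`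
  have hB : Summable (fun j : ℤ => 2 * ‖Cj j‖ ^ 2 + 2 * ‖Sj j‖ ^ 2 + ‖Hj j‖ ^ 2) :=
    ((hC.summable.mul_left 2).add (hS.summable.mul_left 2)).add hH.summable
  have hFsum : Summable (fun j : ℤ => if j ∈ P then 2 * ‖Cj j‖ ^ 2 - 2 * ‖Sj j‖ ^ 2 else ‖Hj j‖ ^ 2) := by
    refine Summable.of_norm_bounded hB (fun j => ?_)
    split_ifs with hj
    · rw [Real.norm_eq_abs, abs_le]
      constructor <;> nlinarith [sq_nonneg ‖Cj j‖, sq_nonneg ‖Sj j‖, sq_nonneg ‖Hj j‖]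
    · rw [Real.norm_eq_abs, abs_of_nonneg (by positivity)]
      nlinarith [sq_nonneg ‖Cj j‖, sq_nonneg ‖Sj j‖]
  -- the pointwise minorant `L j = |H_j|² - 2|E_j|² - 2|S_j|²` and its sum
  have hL : HasSum (fun j : ℤ => ‖Hj j‖ ^ 2 - 2 * ‖Ej j‖ ^ 2 - 2 * ‖Sj j‖ ^ 2)
      ((2 * π / s) * (∫ x : ℝ, ‖g x‖ ^ 2)
        - 2 * ((2 * π / s) * ∫ x, ‖g x * (((Real.cosh (δ * x) - 1 : ℝ)) : ℂ)‖ ^ 2)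
        - 2 * ((2 * π / s) * ∫ x, ‖g x * ((Real.sinh (δ * x) : ℝ) : ℂ)‖ ^ 2)) :=
    (hH.sub (hE.mul_left 2)).sub (hS.mul_left 2)
  have hLF : ∀ j : ℤ, ‖Hj j‖ ^ 2 - 2 * ‖Ej j‖ ^ 2 - 2 * ‖Sj j‖ ^ 2
      ≤ (if j ∈ P then 2 * ‖Cj j‖ ^ 2 - 2 * ‖Sj j‖ ^ 2 else ‖Hj j‖ ^ 2) := by
    intro j
    split_ifs with hj
    · -- `H_j = C_j - E_j`, so `|H_j|² ≤ 2|C_j|² + 2|E_j|²`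
      have hHCE : Hj j = Cj j - Ej j := by
        simp only [hHj, hCj, hEj]
        rw [hCE j]
        ring
      have h1 : ‖Hj j‖ ≤ ‖Cj j‖ + ‖Ej j‖ := by rw [hHCE]; exact norm_sub_le _ _
      have h2 : ‖Hj j‖ ^ 2 ≤ (‖Cj j‖ + ‖Ej j‖) ^ 2 := pow_le_pow_left₀ (norm_nonneg _) h1 2
      nlinarith [sq_nonneg (‖Cj j‖ - ‖Ej j‖), h2]
    · nlinarith [sq_nonneg ‖Ej j‖, sq_nonneg ‖Sj j‖]
  refine ⟨by rw [hF]; exact hFsum, ?_⟩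
  rw [hF]
  have hle := hasSum_le hLF hL hFsum.hasSum
  have h1 : (2 * π / s) * ∫ x, ‖g x * ((Real.sinh (δ * x) : ℝ) : ℂ)‖ ^ 2
      ≤ (2 * π / s) * (Real.sinh (δ * a) ^ 2 * ∫ x, ‖g x‖ ^ 2) :=
    mul_le_mul_of_nonneg_left hSle hT.le
  have h2 : (2 * π / s) * ∫ x, ‖g x * (((Real.cosh (δ * x) - 1 : ℝ)) : ℂ)‖ ^ 2
      ≤ (2 * π / s) * ((Real.cosh (δ * a) - 1) ^ 2 * ∫ x, ‖g x‖ ^ 2) :=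
    mul_le_mul_of_nonneg_left hEle hT.le
  nlinarith [hle, h1, h2]

/-- **Corollary (nonnegativity).**  Under `4 cosh(δa) (cosh(δa) - 1) ≤ 1` — equivalently
`2 sinh²(δa) + 2(cosh(δa) - 1)² ≤ 1`, i.e. `δa ≤ arccosh((1 + √2)/2) ≈ 0.6329` — the zero-side functional of
EVERY mixed configuration `Z(P, δ)` is `≥ 0` on EVERY test function in the window. -/
theorem soloBlind_universal_nonneg (s δ a u₀ : ℝ) (hs : 0 < s) (ha : 0 < a) (hδ : 0 ≤ δ)
    (haT : 2 * a ≤ 2 * π / s) (hsmall : 4 * Real.cosh (δ * a) * (Real.cosh (δ * a) - 1) ≤ 1)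
    (P : Set ℤ) [DecidablePred (· ∈ P)]
    {g : ℝ → ℂ} (hg : MemLp g 2 volume) (hsupp : Function.support g ⊆ Ioc (-a) a) :
    0 ≤ ∑' j : ℤ, (if j ∈ P then
        2 * ((∫ x : ℝ, g x * cexp (I * (((u₀ + j * s : ℝ) : ℂ) - I * δ) * (x : ℂ))) *
            conj ((∫ x : ℝ, g x * cexp (I * (((u₀ + j * s : ℝ) : ℂ) + I * δ) * (x : ℂ))))).re
      else ‖(∫ x : ℝ, g x * cexp (I * (((u₀ + j * s : ℝ) : ℂ)) * (x : ℂ)))‖ ^ 2) := by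
  obtain ⟨-, h⟩ := soloBlind_universal_invisible s δ a u₀ hs ha hδ haT P hg hsupp
  have hsq : Real.sinh (δ * a) ^ 2 = Real.cosh (δ * a) ^ 2 - 1 := by
    nlinarith [Real.cosh_sq (δ * a)]
  have hfac : 0 ≤ 1 - 2 * Real.sinh (δ * a) ^ 2 - 2 * (Real.cosh (δ * a) - 1) ^ 2 := by
    rw [hsq]; nlinarith [hsmall]
  have hint : 0 ≤ ∫ x : ℝ, ‖g x‖ ^ 2 := integral_nonneg (fun x => by positivity)
  have hT : 0 ≤ 2 * π / s := by positivity
  have := mul_nonneg (mul_nonneg hT hfac) hint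
  linarith

/-- **Corollary (an explicit depth).**  Pairs of common depth `δ ≤ 4/(7a)` are invisible in every mixed
configuration for every test function (`cosh(4/7) ≤ 49/41` via `cosh y ≤ e^{y²/2} ≤ 1/(1 - y²/2)`, and
`4 · (49/41) · (8/41) ≤ 1`). -/
theorem soloBlind_universal_nonneg_of_le (s δ a u₀ : ℝ) (hs : 0 < s) (ha : 0 < a) (hδ : 0 ≤ δ)
    (haT : 2 * a ≤ 2 * π / s) (hδa : δ * a ≤ 4 / 7)
    (P : Set ℤ) [DecidablePred (· ∈ P)]
    {g : ℝ → ℂ} (hg : MemLp g 2 volume) (hsupp : Function.support g ⊆ Ioc (-a) a) :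
    0 ≤ ∑' j : ℤ, (if j ∈ P then
        2 * ((∫ x : ℝ, g x * cexp (I * (((u₀ + j * s : ℝ) : ℂ) - I * δ) * (x : ℂ))) *
            conj ((∫ x : ℝ, g x * cexp (I * (((u₀ + j * s : ℝ) : ℂ) + I * δ) * (x : ℂ))))).re
      else ‖(∫ x : ℝ, g x * cexp (I * (((u₀ + j * s : ℝ) : ℂ)) * (x : ℂ)))‖ ^ 2) := by
  apply soloBlind_universal_nonneg s δ a u₀ hs ha hδ haT _ P hg hsupp
  set y : ℝ := δ * a with hy
  have hy0 : 0 ≤ y := by rw [hy]; positivity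
  have hy2 : y ^ 2 / 2 ≤ 8 / 49 := by nlinarith [hδa, hy0]
  have hc1 : Real.cosh y ≤ Real.exp (y ^ 2 / 2) := Real.cosh_le_exp_half_sq y
  have hc2 : Real.exp (y ^ 2 / 2) ≤ 1 / (1 - y ^ 2 / 2) :=
    Real.exp_bound_div_one_sub_of_interval (by positivity) (by linarith)
  have hc3 : 1 / (1 - y ^ 2 / 2) ≤ 49 / 41 := by
    rw [div_le_div_iff₀ (by linarith) (by norm_num)]
    linarith
  have hc : Real.cosh y ≤ 49 / 41 := hc1.trans (hc2.trans hc3)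
  have hc0 : 1 ≤ Real.cosh y := Real.one_le_cosh y
  nlinarith [hc, hc0]

end Summit.RiemannHypothesis.RiemannHypothesis.Theorems
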